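import Summits.SmoothPoincare4.SmoothPoincare4.Theses.CyclicSymmetryRung
import Literature.Topology.FourManifolds.HomotopySpheres
import Literature.Topology.FourManifolds.HomotopyS4CompactProofs
import Literature.Topology.FourManifolds.HomotopyS4OrientableProofs
import HarnessLib

/-!
# Line `birth` — BC3 skeleton for the crux `CyclicSymmetryRung.GenInfty` (stmt-SmoothPoincare4-5981)

Route `route-SmoothPoincare4-CyclicSymmetryRung` (rank-6 crux, "generation"), decl
`Summit.SmoothPoincare4.SmoothPoincare4.Theses.CyclicSymmetryRung.GenInfty`:

  every smooth homotopy 4-sphere `M` (Hausdorff, second countable, `C^∞` atlas on `ℝ⁴`,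
  `Nonempty (M ≃ₕ S⁴)` — the bare carriers of `SmoothPoincare4`) admits, for every `n`, a
  self-diffeomorphism `f` of PRIME ORDER `p ≥ n` (`(⇑f)^[p] = id`, `⇑f ≠ id`).

Standing of the crux (item notes, refuter/grounder 2026-08-15): TRUE for `M ≅ S⁴` (rotations);
`SmoothPoincare4 → GenInfty`; the converse is open and, together with the on-chain crux `SymInfty`,
`SymInfty ∧ GenInfty ↔ SmoothPoincare4` (the route's `closes`). No construction of symmetries of an
unknown smooth `Σ` exists in print (Edmonds' survey arXiv:0907.0454, Problem 19: "Find a smooth,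
simply connected, closed 4-manifold with no nontrivial smooth symmetries … a project for gauge
theory"; Edmonds 1987 Thm. 5.4 gives LOCALLY LINEAR `ℤ/p`-actions on every closed simply connected
topological 4-manifold, `p > 3`, and is forced into TOP at the capping step). No `Disproof.lean`, no
`Lines/*`, no crux ideas, no landed `Theorems/GenInfty/Negative/*` for this crux; negatives index of
the summit empty (2026-08-17).

## The line: symmetry from the ARITHMETIC of the connected-sum monoid of homotopy 4-spheres

The move. A homotopy sphere that is a `p`-fold connected-sum power `Y # ⋯ # Y` is `p`-PERIODIC:
the cyclic permutation of the summands is a diffeomorphism of order `p` (equivariant connected sum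
of `p` copies of `Y` at a free orbit of the order-`p` rotation of `S⁴` in one 2-plane of `ℝ⁵`;
equivalently, `Y^{#p}` is the `p`-fold cyclic branched cover of `Y` along an unknotted 2-sphere in
a ball). So `GenInfty` holds for every `Σ` that is a `p`-th power for infinitely many primes `p` —
and in a FINITE group every element is a `p`-th power for every prime `p` coprime to the group
order (`a·p ≡ 1 (mod d)` gives `(Σ^a)^p = Σ`). Hence:

  FINITE ORDER of `Σ` in the oriented connected-sum monoid `(𝓜₄, #)` of homotopy 4-spheres
  (some power `Σ^{#d} ≅ S⁴`, `d ≥ 1`) ⟹ `Σ ≅ (Σ^{#a})^{#p}` for every prime `p > d`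
  ⟹ `Σ` carries a diffeomorphism of every prime order `p > d` ⟹ `GenInfty` at `Σ`.

In every dimension `n ≥ 5` the first step is Kervaire–Milnor's theorem that `Θₙ` is a FINITE
group (Ann. of Math. 77 (1963), Thm. 1.2), so the argument proves the `n`-dimensional analogue of
`GenInfty` outright (exotic spheres are very symmetric: they even carry `ℤ/p`-actions for all large
`p`). In dimension 4 the first step is OPEN and is exactly the existing open SUPPORT item
`QuotientSpheres.FiniteOrder` (stmt-SmoothPoincare4-8194, route `route-SmoothPoincare4-QuotientSpheres`,
"the dimension-4 shape of Kervaire–Milnor finiteness"), whose body stub 1 repeats VERBATIM (so the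
stub closes by `exact` from any proof of that item, and no new statement is put into circulation).
`FiniteOrder` is implied by `SmoothPoincare4` (order 1) and is not known to imply it: finite order
forces invertibility (`Σ # Σ^{#(d-1)} ≅ S⁴`, i.e. `SchoenfliesSplit.SchsplitInvertible`,
stmt-SmoothPoincare4-0373), and invertible homotopy 4-spheres are standard only modulo the smooth
4-dimensional Schoenflies conjecture (`Σ ∖ pt ⊂ S⁴` would be a Schoenflies ball). So the line
transfers the generation crux from "construct symmetries of an unknown `Σ`" (no tool) to "bound the
order of `Σ` under `#`" (tools: Kirby calculus on families closed under `#`, e.g. Gluck twists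
`Σ_{K₁ # K₂} ≅ Σ_{K₁} # Σ_{K₂}`; stabilisation/dissolution theorems; the h-cobordism
`Σ ~ S⁴` of Wall), and it explains WHY arbitrarily large primes: all `p > d` at once.

## The three registered stubs

* `stub_finiteOrder` — **OPEN, the hard stub (= item stmt-SmoothPoincare4-8194 verbatim):** every
  homotopy 4-sphere `Σ` (tree structure `Literature.Topology.FourManifolds.HomotopySphere 4`:
  closed smooth oriented 4-manifold with `Nonempty (Σ ≃ₕ S⁴)`) is diffeomorphic to `S⁴`, or some
  oriented connected-sum power is: a chain `T₀ = Σ # Σ`, `T_{i+1} = T_i # Σ` (`i < m`, oriented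
  sums `Literature.Topology.FourManifolds.IsOrientedConnectedSum`, the orientation of `Σ` fixed
  throughout) with `T_m ≅ S⁴`, i.e. `Σ^{#(m+2)} ≅ S⁴`. Why it might fail: an exotic `Σ` of
  infinite order, or a non-invertible one (`Σ ∖ pt ⊄ ℝ⁴`: the end-standard smoothing `Σ ∖ pt` of
  `ℝ⁴` need not be small) — nothing known forces finite order in `𝓜₄`, and every
  homotopy-sphere-sum-stable invariant is blind to it (`Literature.Barriers.SmoothPoincare4.
  GaugeInvariantsBlind`). Sources: KervaireMilnorAnnals1963 Thm. 1.1/1.2 and §2; route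
  QuotientSpheres (FiniteOrder, NoTwoTorsion); route SchoenfliesSplit (SchsplitInvertible);
  doi:10.4171/qt/5 p. 3 fn. Size: open problem.
* `stub_primeRoots` — **KNOWN (monoid arithmetic; size L in Lean modulo the tree's Kervaire–Milnor
  named facts):** if `Σ` satisfies the conclusion of stub 1, then there is a threshold `B` such
  that for every prime `p > B` the sphere `Σ` is a `p`-fold oriented connected-sum power up to
  diffeomorphism: there are a homotopy 4-sphere `Y` and a chain `R₀ ≅ S⁴`, `R_{j+1} = R_j # Y`
  (`j < p`, oriented) with `R_p ≅ Σ`. Proof in print-level detail: `B := 0` if `Σ ≅ S⁴` (take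
  `Y := ` the standard sphere, `R_j :=` standard spheres, `S⁴ # S⁴ ≅⁺ S⁴` by
  `isOrientedConnectedSum_sphere_self`); otherwise `B := m + 2 =: d`, and for a prime `p > d`
  pick `a ≥ 1` with `a·p ≡ 1 (mod d)` (`p ∤ d`), put `Y := Σ^{#a}`, `R_j := Y^{#j}`; then
  `R_p = Σ^{#ap} = Σ # (Σ^{#d})^{#k} ≅⁺ Σ` by the monoid laws of the oriented connected sum of
  closed connected oriented 4-manifolds — well-definedness up to orientation-preserving
  diffeomorphism, associativity, commutativity, unit `S⁴` (Kervaire–Milnor 1963, Lemma 2.1, valid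
  in every dimension; tree named facts `exists_diffeomorph_isOrientationPreserving_of_isOrientedConnectedSum`,
  `isOrientedConnectedSum_assoc`, `isOrientedConnectedSum_sphere_self`, `exists_isOrientedConnectedSum`,
  `HomotopySphere.nonempty_homotopyEquiv_sphere_of_isConnectedSum`). Why it might fail: it does
  not (ZFC theorem); the formal risks are the vendored Lemma-2.1 facts in dimension 4 (true in all
  dimensions, partly discharged in the tree) and the bookkeeping of chains. [cite:
  KervaireMilnorAnnals1963, Lemma 2.1–2.2]
* `stub_cyclicPowerSymmetry` — **KNOWN (equivariant connected sum; size L–XL in Lean):** for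
  `p ≥ 2`, the end `R_p` of an oriented connected-sum chain `R₀ ≅ S⁴`, `R_{j+1} = R_j # Y`
  (`Y` a homotopy 4-sphere) carries a diffeomorphism `g` with `(⇑g)^[p] = id` and `⇑g ≠ id`.
  Proof: let `ρ` be the rotation by `2π/p` in the `(x₄,x₅)`-plane of `ℝ⁵` restricted to `S⁴`
  (order `p`, fixed set `S²`, free orbits elsewhere); choose an orientation-preserving disc
  `D ⊂ S⁴ ∖ Fix ρ` with `D, ρD, …, ρ^{p-1}D` pairwise disjoint and form the connected sum `N` of
  `S⁴` with `p` copies of `Y` along these discs, glued by `ρ`-translates of one gluing; `ρ` on the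
  core together with the cyclic shift of the copies is a diffeomorphism of `N` of order exactly
  `p` (it moves the points of the core off `Fix ρ`). By uniqueness and associativity of oriented
  connected sums (Kervaire–Milnor Lemma 2.1 = Palais–Cerf disc theorem) `N ≅⁺ (((S⁴ # Y) # Y) ⋯) # Y
  = R_p`, and the symmetry is transported by conjugation. (Equivalently `N` is the `p`-fold cyclic
  branched cover of `Y` along an unknotted 2-sphere in a ball — the picture used, downward, by
  route QuotientSpheres.) Why it might fail: it does not; formal size is the connected-sum /
  disc-theorem infrastructure (`Literature.Topology.FourManifolds.ConnectedSum`, named facts) plus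
  an explicit equivariant gluing. [cite: KervaireMilnorAnnals1963, Lemma 2.1] [cite: Kosinski1993,
  Ch. VI §1] [cite: Bredon1972] [cite: HambletonHausmann2010, App. (cyclic branched covers)]
* `GenInfty_of : stub₁-sig → stub₂-sig → stub₃-sig → GenInfty` — the REAL composition (sorry-free):
  package the bare `M` of `GenInfty` as a `HomotopySphere 4` (compact by the PROVED tree theorem
  `compactSpace_of_homotopyEquiv_sphere_four_holds`, Hatcher 3.29; oriented by the PROVED
  `isOrientable_of_homotopyEquiv_sphere_four_holds`, Lee Thm. 15.43); stub 2 ∘ stub 1 give the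
  threshold `B`; `Nat.exists_infinite_primes` gives a prime `p > max n B`; stub 2 gives the
  `p`-chain `R` with `φ : R_p ≅ M`; stub 3 gives `g` on `R_p`; `f := φ ∘ g ∘ φ⁻¹` has
  `f^[p] = φ ∘ g^[p] ∘ φ⁻¹ = id` (`Function.Semiconj.iterate_right`) and `f ≠ id`.
* `GenInfty_of_stubs : GenInfty` — the crux BY NAME from the three declared stubs (the only
  `sorry`s of the file).

BC3 probes (planner folder `bc/probe_*.lean`, 2026-08-17; quoted in NOTES.md): for each stub,
`stub → GenInfty` and `stub → SmoothPoincare4` by `first | exact? | simpa | aesop` FAIL — stub 1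
speaks of connected-sum chains, never of self-maps; stubs 2–3 are conditional statements about
GIVEN chains. Logical status: `SmoothPoincare4 ⇒ stub 1 ⇒ (with the theorems stub 2, stub 3)
GenInfty`; `GenInfty ⇏ stub 1` and `stub 1 ⇏ SmoothPoincare4` known (the latter ⇔ smooth 4D
Schoenflies for invertible spheres). Disproof used: none exists for this crux (`ledger crux ls`
empty); the line uses no hypothesis a `_false_without_` lemma could name.
-/

noncomputable section

open scoped Manifold ContDiff Topology
open ContinuousMap
open Literature.Topology.FourManifolds
open Summit.SmoothPoincare4.SmoothPoincare4.Theses.CyclicSymmetryRung (GenInfty)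

-- `Summit.<Summit>.<Problem>`: for the single-conjunct summit the duplicate segment is mandated.
set_option linter.dupNamespace false
set_option linter.unusedVariables false

namespace Summit.SmoothPoincare4.SmoothPoincare4.Cruxes.GenInfty.Birth

/-- Local notation: the standard `S⁴ ⊂ ℝ⁵`. -/
local notation "𝕊⁴" => (Metric.sphere (0 : EuclideanSpace ℝ (Fin 5)) 1)

/-! ## The three registered stubs (`sorry` lives ONLY here) -/

/-- **Stub 1 (OPEN — the hard stub): every homotopy 4-sphere has finite order in the oriented
connected-sum monoid.** VERBATIM the body of the open support item
`Summit.SmoothPoincare4.SmoothPoincare4.Theses.QuotientSpheres.FiniteOrder`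
(stmt-SmoothPoincare4-8194): for every homotopy 4-sphere `Σ` (closed smooth oriented 4-manifold
homotopy equivalent to `S⁴`), either `Σ ≅ S⁴`, or there is an oriented connected-sum chain
`T₀ = Σ # Σ`, `T_{i+1} = T_i # Σ` (`i < m`) of homotopy 4-spheres ending at `T_m ≅ S⁴`
(`Σ^{#(m+2)} ≅ S⁴`). The dimension-4 shape of Kervaire–Milnor's finiteness of `Θₙ`
(Thm. 1.2, `n ≠ 4`); implied by `SmoothPoincare4`; implies invertibility of every homotopy
4-sphere (`SchoenfliesSplit.SchsplitInvertible`); with the smooth 4D Schoenflies conjecture it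
would give `SmoothPoincare4`, without it nothing of the kind is known. Why it might fail: an
exotic `Σ` of infinite order or a non-invertible one; no invariant constrains the order.
[cite: KervaireMilnorAnnals1963, Thm. 1.1–1.2, Lemma 2.1] -/
theorem stub_finiteOrder :
    ∀ S : HomotopySphere 4,
      Nonempty (S.carrier ≃ₘ⟮𝓡 4, 𝓡 4⟯ 𝕊⁴) ∨
        ∃ (m : ℕ) (T : ℕ → HomotopySphere 4),
          IsOrientedConnectedSum S.orientation S.orientation (T 0).orientation ∧
            (∀ i < m, IsOrientedConnectedSum (T i).orientation S.orientation
              (T (i + 1)).orientation) ∧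
            Nonempty ((T m).carrier ≃ₘ⟮𝓡 4, 𝓡 4⟯ 𝕊⁴) := by
  sorry

/-- **Stub 2 (KNOWN — arithmetic of a finite cyclic monoid; Kervaire–Milnor 1963, Lemma 2.1):
finite order gives `p`-th roots for all large primes.** If the homotopy 4-sphere `Σ` is standard
or satisfies `Σ^{#(m+2)} ≅ S⁴` through an oriented chain as in stub 1, then there is a threshold
`B` (`0`, resp. `m + 2`) such that for every prime `p > B` there are a homotopy 4-sphere `Y` and
an oriented connected-sum chain `R₀ ≅ S⁴`, `R_{j+1} = R_j # Y` (`j < p`) with `R_p ≅ Σ`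
(`Y := Σ^{#a}` with `a·p ≡ 1 (mod m+2)`; `R_p = Σ^{#ap} ≅⁺ Σ` by well-definedness, associativity
and the unit law of the oriented connected sum of closed connected oriented manifolds, valid in
every dimension). Why it might fail: it does not; formal risk = the dimension-4 instances of the
tree's Lemma-2.1 named facts and chain bookkeeping.
[cite: KervaireMilnorAnnals1963, Lemma 2.1–2.2 (p. 505)] [cite: Kosinski1993, Ch. VI §1] -/
theorem stub_primeRoots :
    ∀ S : HomotopySphere 4,
      (Nonempty (S.carrier ≃ₘ⟮𝓡 4, 𝓡 4⟯ 𝕊⁴) ∨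
        ∃ (m : ℕ) (T : ℕ → HomotopySphere 4),
          IsOrientedConnectedSum S.orientation S.orientation (T 0).orientation ∧
            (∀ i < m, IsOrientedConnectedSum (T i).orientation S.orientation
              (T (i + 1)).orientation) ∧
            Nonempty ((T m).carrier ≃ₘ⟮𝓡 4, 𝓡 4⟯ 𝕊⁴)) →
      ∃ B : ℕ, ∀ p : ℕ, p.Prime → B < p →
        ∃ (Y : HomotopySphere 4) (R : ℕ → HomotopySphere 4),
          Nonempty ((R 0).carrier ≃ₘ⟮𝓡 4, 𝓡 4⟯ 𝕊⁴) ∧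
            (∀ j < p, IsOrientedConnectedSum (R j).orientation Y.orientation
              (R (j + 1)).orientation) ∧
            Nonempty ((R p).carrier ≃ₘ⟮𝓡 4, 𝓡 4⟯ S.carrier) := by
  sorry

/-- **Stub 3 (KNOWN — equivariant connected sum / cyclic branched cover of the trivial 2-knot):
connected-sum powers are periodic.** For `p ≥ 2`, the end `R_p` of an oriented connected-sum
chain `R₀ ≅ S⁴`, `R_{j+1} = R_j # Y` (`Y` a homotopy 4-sphere) — i.e. `R_p ≅⁺ Y^{#p}` — carries
a diffeomorphism `g` with `g^p = id ≠ g`: sum `p` copies of `Y` into `S⁴` along the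
`ρ`-translates of one disc, `ρ` the order-`p` rotation of `S⁴ ⊂ ℝ⁵` in the `(x₄,x₅)`-plane
(free off its fixed `S²`), so that `ρ` extended by the cyclic shift of the copies is a
diffeomorphism of order `p`; identify the result with `R_p` by uniqueness/associativity of
oriented connected sums (Palais–Cerf disc theorem) and conjugate. Why it might fail: it does not;
formal size = connected-sum infrastructure + one explicit equivariant gluing.
[cite: KervaireMilnorAnnals1963, Lemma 2.1] [cite: Kosinski1993, Ch. VI §1] [cite: Bredon1972]
[cite: HambletonHausmann2010, Appendix] -/
theorem stub_cyclicPowerSymmetry :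
    ∀ (Y : HomotopySphere 4) (R : ℕ → HomotopySphere 4) (p : ℕ), 2 ≤ p →
      Nonempty ((R 0).carrier ≃ₘ⟮𝓡 4, 𝓡 4⟯ 𝕊⁴) →
        (∀ j < p, IsOrientedConnectedSum (R j).orientation Y.orientation
          (R (j + 1)).orientation) →
          ∃ g : (R p).carrier ≃ₘ⟮𝓡 4, 𝓡 4⟯ (R p).carrier, (⇑g)^[p] = id ∧ ⇑g ≠ id := by
  sorry

/-! ## The composition: the three stubs prove the crux BY NAME (no `sorry` below this line) -/

/-- **Composition with explicit hypotheses** (the BC3 shape `stub₁-sig → stub₂-sig → stub₃-sig →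
GenInfty`). Given a bare carrier `M` of `GenInfty` and `n`: `M` is compact
(`compactSpace_of_homotopyEquiv_sphere_four_holds`, PROVED) and orientable
(`isOrientable_of_homotopyEquiv_sphere_four_holds`, PROVED), so it packages as a
`HomotopySphere 4`; stubs 1–2 give a threshold `B`; choose a prime `p > max n B`
(`Nat.exists_infinite_primes`); stub 2 gives `Y`, the chain `R` and `φ : R_p ≃ₘ M`; stub 3 gives
`g` on `R_p` of order `p`; then `f := φ ∘ g ∘ φ⁻¹ : M ≃ₘ M` satisfies `f^[p] = id`
(`Function.Semiconj.iterate_right`) and `f ≠ id`. [cite: KervaireMilnorAnnals1963, §2] -/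
theorem GenInfty_of
    (h₁ : ∀ S : HomotopySphere 4,
      Nonempty (S.carrier ≃ₘ⟮𝓡 4, 𝓡 4⟯ 𝕊⁴) ∨
        ∃ (m : ℕ) (T : ℕ → HomotopySphere 4),
          IsOrientedConnectedSum S.orientation S.orientation (T 0).orientation ∧
            (∀ i < m, IsOrientedConnectedSum (T i).orientation S.orientation
              (T (i + 1)).orientation) ∧
            Nonempty ((T m).carrier ≃ₘ⟮𝓡 4, 𝓡 4⟯ 𝕊⁴))
    (h₂ : ∀ S : HomotopySphere 4,
      (Nonempty (S.carrier ≃ₘ⟮𝓡 4, 𝓡 4⟯ 𝕊⁴) ∨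
        ∃ (m : ℕ) (T : ℕ → HomotopySphere 4),
          IsOrientedConnectedSum S.orientation S.orientation (T 0).orientation ∧
            (∀ i < m, IsOrientedConnectedSum (T i).orientation S.orientation
              (T (i + 1)).orientation) ∧
            Nonempty ((T m).carrier ≃ₘ⟮𝓡 4, 𝓡 4⟯ 𝕊⁴)) →
      ∃ B : ℕ, ∀ p : ℕ, p.Prime → B < p →
        ∃ (Y : HomotopySphere 4) (R : ℕ → HomotopySphere 4),
          Nonempty ((R 0).carrier ≃ₘ⟮𝓡 4, 𝓡 4⟯ 𝕊⁴) ∧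
            (∀ j < p, IsOrientedConnectedSum (R j).orientation Y.orientation
              (R (j + 1)).orientation) ∧
            Nonempty ((R p).carrier ≃ₘ⟮𝓡 4, 𝓡 4⟯ S.carrier))
    (h₃ : ∀ (Y : HomotopySphere 4) (R : ℕ → HomotopySphere 4) (p : ℕ), 2 ≤ p →
      Nonempty ((R 0).carrier ≃ₘ⟮𝓡 4, 𝓡 4⟯ 𝕊⁴) →
        (∀ j < p, IsOrientedConnectedSum (R j).orientation Y.orientation
          (R (j + 1)).orientation) →
          ∃ g : (R p).carrier ≃ₘ⟮𝓡 4, 𝓡 4⟯ (R p).carrier, (⇑g)^[p] = id ∧ ⇑g ≠ id) :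
    GenInfty := by
  intro M _ _ _ _ _ hM n
  obtain ⟨e⟩ := hM
  -- a homotopy 4-sphere is compact (Hatcher 3.29) and orientable (Lee 15.43), proved in the tree
  haveI : CompactSpace M := compactSpace_of_homotopyEquiv_sphere_four_holds M e
  obtain ⟨oM⟩ : Nonempty (SmoothOrientation (𝓡 4) M) :=
    isOrientable_of_homotopyEquiv_sphere_four_holds M e
  -- package `M` as an oriented homotopy 4-sphere `S` (its carrier is `M` by `rfl`)
  let S : HomotopySphere 4 := ⟨M, oM, ⟨e⟩⟩
  -- stub 1 (finite order) and stub 2 (prime roots beyond a threshold `B`)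
  obtain ⟨B, hB⟩ := h₂ S (h₁ S)
  -- a prime `p` exceeding both `n` and `B`
  obtain ⟨p, hp_le, hp⟩ := Nat.exists_infinite_primes (max n B + 1)
  have hmax : max n B < p := hp_le
  have hnp : n ≤ p := le_of_lt (lt_of_le_of_lt (le_max_left n B) hmax)
  have hBp : B < p := lt_of_le_of_lt (le_max_right n B) hmax
  -- stub 2: `S` is a `p`-fold connected-sum power `R p` up to a diffeomorphism `φ`
  obtain ⟨Y, R, hR0, hchain, ⟨φ⟩⟩ := hB p hp hBp
  -- stub 3: the power `R p` carries a diffeomorphism `g` of order `p`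
  obtain ⟨g, hgp, hgne⟩ := h₃ Y R p hp.two_le hR0 hchain
  -- transport `g` to `M = S.carrier` by conjugation with `φ`
  have hsemi : Function.Semiconj (⇑φ) (⇑g) (⇑(φ.symm.trans (g.trans φ))) := by
    intro x
    simp only [Diffeomorph.coe_trans, Function.comp_apply, Diffeomorph.symm_apply_apply]
  refine ⟨p, φ.symm.trans (g.trans φ), hnp, hp, ?_, ?_⟩
  · -- `(φ g φ⁻¹)^[p] = φ g^[p] φ⁻¹ = id`
    funext y
    have hy : (⇑(φ.symm.trans (g.trans φ)))^[p] (φ (φ.symm y)) = φ (((⇑g)^[p]) (φ.symm y)) :=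
      ((hsemi.iterate_right p) (φ.symm y)).symm
    rw [Diffeomorph.apply_symm_apply] at hy
    rw [hy, hgp]
    simp only [id_eq, Diffeomorph.apply_symm_apply]
  · -- `φ g φ⁻¹ = id` would force `g = id`
    intro hf
    apply hgne
    funext x
    have hx : φ (g x) = (⇑(φ.symm.trans (g.trans φ))) (φ x) := hsemi x
    rw [hf, id_eq] at hx
    have hx' := congrArg (⇑φ.symm) hx
    simpa only [Diffeomorph.symm_apply_apply, id_eq] using hx'

/-- **THE SKELETON THEOREM.** The crux
`Summit.SmoothPoincare4.SmoothPoincare4.Theses.CyclicSymmetryRung.GenInfty`, concluded BY NAME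
from the three DECLARED stubs `stub_finiteOrder`, `stub_primeRoots`, `stub_cyclicPowerSymmetry`
(the only `sorry`s of the file) through the sorry-free composition `GenInfty_of`.
[cite: KervaireMilnorAnnals1963, §2] -/
theorem GenInfty_of_stubs : GenInfty :=
  GenInfty_of stub_finiteOrder stub_primeRoots stub_cyclicPowerSymmetry

end Summit.SmoothPoincare4.SmoothPoincare4.Cruxes.GenInfty.Birth

end
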